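/-
Copyright (c) 2026 the pub-hodgecm2 formalisation cell (harness21).  New file, outside the frozen port manifest.
Origin: seat `prover-pub-hodgecm2-rekey-l0-pin-a-g0-0` (ι₁∕Id CHAIN row I4, ASSEMBLER d2bridge-plan g3 TABLE v1.2, WORLD = C), 2026-08-23 —
the UNTWISTED twin of ✔ `CorCM/D2Bridge/ComponentAlbanese.lean` (d2bridge-prove-2): the SAME structure over the §4.2 datum of the untwisted honest
Prop-C.5 datum `Model.honestP5IdOf` (instlevel-a, `B01/Transposition/HComp/HonestP5Id.lean`) instead of `Model.honestP5Of`; token flip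
`honestP5Of ↦ honestP5IdOf`, names `+Id`, nothing else.  One structure + one definition + one theorem; no named fact, no `sorry`, no new axiom;
HC_CM is NOT proved.
-/
import Summits.HodgeConjecture.HodgeCM.Model.TowerRes
import Summits.HodgeConjecture.HodgeCM.Model.TowerAlgebra
import Summits.HodgeConjecture.CorCM.B01.Transposition.HComp.HonestP5Id
import Literature.NumberTheory.Automorphic.Liu2021.AppendixC.HeckeTranslates
import Literature.AlgebraicGeometry.Motives.AbelianVarietyBaseChange
import HarnessLib

set_option autoImplicit false

/-!
# Δ2 bridge, ι₁∕Id chain (row I4): the J2 ⇄ J-record INTERFACE over the UNTWISTED datum (`ComponentAlbaneseId`)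

Y. Liu, *Fourier–Jacobi cycles and arithmetic relative trace formula*, Camb. J. Math. **9** (2021) 1–147 = arXiv:2102.11518 [Liu2021];
TeX source `FJcycle.tex` (`l. NNNN` = its lines).

The ONE interface between the J2 pin (d2bridge-prove-5, `CorCM/D2Bridge/AlbaneseOnComponents.lean`: Liu's Albanese morphism `(α_{X_K})_x`
restricted to the components `P_{Γ_K,h}` of `X_K ⊗_{E,ι₁} ℂ`, proof of Lem. 2.4 (1) l. 1220–1222) and the J-record pin (d2bridge-prove-2,
`CorCM/D2Bridge/Map43RecordAtPinLevels.lean` ∕ `Map43RecordAtPin.lean`: the proof-objects record `Map43RationalData` of the map (4.2)/(4.3), proof of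
Thm. 4.18 l. 2247–2253, at the model's tower) — HERE OVER THE UNTWISTED DATUM: `C : Sec42Data (Model.honestP5IdOf h F ι₁ V Φ) isotropicAt`
(`X_K = M_K` by `rfl`, the record system itself, ✔-desk `HComp/Sec42DataIdOf.lean`; under WORLD = C this is Liu's model of our pieces — the
coordinate embedding `ι₁` is instance, tail and key at once; ASSEMBLER TABLE v1.2 row I4, «NOT P5-generic: four fields would need `P5.G = ↥V.adelicFin`
casts», cmside-b census §C).  A STRUCTURE `ComponentAlbaneseId hHD hI hU h₃ hA V h Φ C T` whose fields are EXACTLY the J2 pin's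
deliverables — the level dictionary `Γof` (+ three order laws), the component Albanese morphisms `alb K h : P_{Γ_K,h} ⟶ A_K ⊗ ℂ`, and their laws
ON `H¹(−; ℚ)`: (ii) coherence along the tower relation `Rel`, (iii) the level-transition square with `C.Atr f`, (iv) the Hecke square with
`T.albTr g`, (v′) hom-level detection — plus `transport` along an equality of §4.2 data and the corollary `eq_zero_of_pull_alb_comp_eq_zero`.
This file imports NEITHER pin (only the model's tower files, the §4.2 vocabulary and the untwisted datum), so rows I5 (the pin, `ComponentAlbanesePinId`)
and I6 (the record, `Map43RecordAtPinLevelsId`) file against it independently.  Field texts = ✔ `ComponentAlbanese` :70–:102 VERBATIM (the one token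
`honestP5Of ↦ honestP5IdOf` sits in the type of `C`).  Nothing is asserted; HC_CM is NOT proved; «Δ2 BRIDGE CLOSED» is NOT claimed.

## References
* [Liu2021] §2.1 Def. 2.3, Lem. 2.4 (1) with proof (l. 1202–1228); §4.2 l. 2062–2074.
* Tree: ✔ `CorCM/D2Bridge/ComponentAlbanese.lean` (the twisted original, d2bridge-prove-2), `HodgeCM/Model/TowerLevel_1 ∕ LevelTranslate ∕ LevelConjugate ∕ Universe`,
  `Liu2021/AppendixC/Glue ∕ HeckeTranslates`, `CorCM/B01/Transposition/HComp/HonestP5Id` (instlevel-a, row I0), `CorCM/D2Bridge/AlbaneseOnPiece{Core,Functorial,Cofan}`.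
-/

noncomputable section

open scoped TensorProduct
open CategoryTheory NumberField Function
open Literature.AlgebraicGeometry.Motives (AbelianVariety bettiCohomology)
open Literature.AlgebraicGeometry.HodgeTheory
open Literature.AlgebraicGeometry.ShimuraVarieties.UnitaryCanonicalModel (exists_recordSystem)
open Literature.NumberTheory.Automorphic Literature.NumberTheory.Automorphic.Liu2021 Literature.NumberTheory.Automorphic.Liu2021.AppendixC
open Literature.NumberTheory.Automorphic.PicardCM
open Literature.NumberTheory.Transcendental (Arapura2012_Cor_15_4_6)
open HodgeCM.Model.LevelTranslate HodgeCM.Model.TowerLevel HodgeCM.Model.TowerCarrier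

namespace Summit.HodgeConjecture.CorCM.D2Bridge.Iota1

/- Filing shape (coordinator 2026-08-23T23:36Z rule (2)): NO section `variable` carrying a named fact — the structure's parameters are
HEADER binders, in the live file's order `hHD hI hU h₃ hA {L} {ι₁} V h Φ {isotropicAt} C T [Algebra L ℂ]`, so every twin token-flips cleanly. -/

/-! ## §1  The J2 interface over the untwisted datum: Albanese on components -/

/-- **The J2 pin «ALBANESE ON COMPONENTS» OVER THE UNTWISTED DATUM, as an interface** (twin of ✔ `ComponentAlbanese`; [Liu2021] proof of Lem. 2.4 (1), l. 1220–1222: «pick `x ∈ X(π₀(X ⊗_{k,τ} ℂ))`,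
which induces `(α_X)_x : X ⊗ ℂ → Alb_X ⊗ ℂ`», restricted to the pieces; §4.2 l. 2062–2074).  For the §4.2 datum `C` (levels `K ⊆ K₀`,
`X_K`, `A_K = Alb_{X_K}`, transitions `Atr`, Hecke translates `T.albTr`) and the model's tower over `(L, ι₁, V)` (components
`P_{Γ,h} = U.pms L ι₁ V (Γ.conj h)`): a level dictionary `Γof` (monotone, compatible with conjugation), for every `K` and index `h` a
`ℂ`-morphism `alb K h : P_{Γ_K,h} ⟶ A_K ⊗_{E,ι₁} ℂ` (at the pin `albOnPiece (C.alb K) inj_h y_h`), and its laws ON `H¹(−; ℚ)`: (ii) coherence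
along the tower relation `Rel`, (iii) the level-transition square with `C.Atr f`, (iv) the Hecke square with `T.albTr g`, (v′) HOM-LEVEL
DETECTION of `E`-homomorphisms out of `A_K`.  Nothing is asserted: every field is a theorem of the J2 pin file.
[cite: Liu2021, proof of Lemma 2.4 (1) (FJcycle.tex l. 1220–1228); §4.2 l. 2062–2074] -/
structure ComponentAlbaneseId (hHD : exists_isReal_hodgeModel) (hI : hodgePQ_independent_of_hodgeModel)
    (hU : BallQuotientUniformisedDatum) (h₃ : CMAbelianVarietyRealised) (hA : Arapura2012_Cor_15_4_6)
    {L : HodgeCM.CMField} {ι₁ : L →+* ℂ} (V : HodgeCM.HermSpace3 L ι₁) (h : exists_recordSystem)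
    (Φ : Literature.AlgebraicGeometry.Motives.CMType L) {isotropicAt : ℕ → Prop}
    (C : Sec42Data (Model.honestP5IdOf h ⟨L.K⟩ ι₁ ⟨V.Hm, V.isHermitian, V.signature_ι₁, V.posDef_of_ne⟩ Φ) isotropicAt)
    (T : C.HeckeTranslates) [Algebra L ℂ] where
  /-- ⟨pin⟩ the model's level of a sufficiently small open compact `K ⊆ K₀` (at the pin: `K` itself, paired with `U(L⁺) ∩ K`). -/
  Γof : C5.SmallLevel C.S.K₀ → HodgeCM.Level V
  /-- ⟨pin⟩ every such level is below a conjugate of `K_f(3)`. -/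
  belowConjThree : ∀ K, (Γof K).BelowConjThree
  /-- ⟨pin⟩ the dictionary is monotone. -/
  Γof_mono : ∀ {K K' : C5.SmallLevel C.S.K₀}, K' ≤ K → Γof K' ≤ Γof K
  /-- ⟨pin⟩ the dictionary is compatible with the Hecke condition `g⁻¹ K₁ g ⊆ K` (i.e. `K₁ ⊆ g K g⁻¹`). -/
  Γof_hecke : ∀ (g : ↥V.adelicFin) {K₁ K : C5.SmallLevel C.S.K₀}, C5.HeckeLE g K₁ K → Γof K₁ ≤ (Γof K).conj g (belowConjThree K)
  /-- ⟨pin⟩ `(α_{X_K})_x|_{P_{Γ_K,h}} : P_{Γ_K,h} ⟶ A_K ⊗_{E,ι₁} ℂ`, the Albanese morphism on the component of index `h`. -/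
  alb : ∀ (K : C5.SmallLevel C.S.K₀) (g : ↥V.adelicFin),
    Var.scheme hU h₃ (.pms (HodgeCM.Model.pmsCode L ι₁ V ((Γof K).conj g (belowConjThree K)))) ⟶ ((C.A K).baseChange ℂ).X
  /-- ⟨pin law (ii)⟩ coherence on `H¹` along the tower relation: `(alb K h)^* = t_γ^* ∘ (alb K h')^*` for `h' ∈ (γ)_f h K`. -/
  pull_alb_rel : ∀ (K : C5.SmallLevel C.S.K₀) (γ : ↥(Urat V)) (g g' : ↥V.adelicFin) (r : Rel (Γof K) γ g g'),
    BettiUniverse.pull (alb K g) 1 =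
      (HodgeCM.Model.universeOf hHD hI hU h₃).pull (transMorU hU h₃ hHD hI hA γ.2 ((Γof K).conj g (belowConjThree K))
          ((Γof K).conj g' (belowConjThree K)) (transCond_of_rel (belowConjThree K) r)) 1 ∘ₗ BettiUniverse.pull (alb K g') 1
  /-- ⟨pin law (iii)⟩ the level-transition square on `H¹`: `(alb K' h)^* ∘ (Alb_{u^{K'}_K})_ℂ^* = t_1^* ∘ (alb K h)^*`. -/
  pull_alb_Atr : ∀ {K K' : C5.SmallLevel C.S.K₀} (f : K' ⟶ K) (g : ↥V.adelicFin),
    BettiUniverse.pull (alb K' g) 1 ∘ₗ BettiUniverse.pull (AbelianVariety.Hom.baseChange ℂ (C.Atr f)).hom.hom.hom 1 =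
      (HodgeCM.Model.universeOf hHD hI hU h₃).pull (transMorU hU h₃ hHD hI hA (1 : ↥(Urat V)).2 ((Γof K').conj g (belowConjThree K'))
          ((Γof K).conj g (belowConjThree K)) (transCond_conj_of_le (Γof_mono f.le) (belowConjThree K) (belowConjThree K') g)) 1 ∘ₗ BettiUniverse.pull (alb K g) 1
  /-- ⟨pin law (iv)⟩ the Hecke square on `H¹`: `(alb K₁ h)^* ∘ (Alb(T_g))_ℂ^* = t_1^* ∘ (alb K (h g))^*` for `g⁻¹ K₁ g ⊆ K`. -/
  pull_alb_albTr : ∀ (g : ↥V.adelicFin) {K₁ K : C5.SmallLevel C.S.K₀} (hK : C5.HeckeLE g K₁ K) (g' : ↥V.adelicFin),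
    BettiUniverse.pull (alb K₁ g') 1 ∘ₗ BettiUniverse.pull (AbelianVariety.Hom.baseChange ℂ (T.albTr g K₁ K hK)).hom.hom.hom 1 =
      (HodgeCM.Model.universeOf hHD hI hU h₃).pull (transMorU hU h₃ hHD hI hA (1 : ↥(Urat V)).2 ((Γof K₁).conj g' (belowConjThree K₁))
          ((Γof K).conj (g' * g) (belowConjThree K))
          ((transCond_conj_of_le (Γof_hecke g hK) ((belowConjThree K).conj g) (belowConjThree K₁) g').one_trans
            (transCond_conj_conj (belowConjThree K) g g'))) 1 ∘ₗ BettiUniverse.pull (alb K (g' * g)) 1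
  /-- ⟨pin law (v′)⟩ hom-level detection: the `(alb K h)^*` jointly see (the complexification of) every non-zero homomorphism
  `φ : A_K → B` over `E` (prove-3's `exists_pull_albOnPiece_baseChange_ne_zero'` at the representatives). -/
  alb_detect : ∀ (K : C5.SmallLevel C.S.K₀) {B : AbelianVariety L} (φ : C.A K ⟶ B), φ ≠ 0 →
    ∃ g : ↥V.adelicFin, BettiUniverse.pull (alb K g ≫ (AbelianVariety.Hom.baseChange ℂ φ).hom.hom.hom) 1 ≠ 0

namespace ComponentAlbaneseId


/-- **Transport of the interface along an equality of §4.2 data** (for the glue `sec42DataIdOfFourLe … = sec42DataIdOf …`,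
`sec42DataIdOf_eq_of_four_le` of row I1, whose Hecke translates (row I2) are DEFINED as the corresponding `cast`). [folklore] -/
def transport {hHD : exists_isReal_hodgeModel} {hI : hodgePQ_independent_of_hodgeModel}
    {hU : BallQuotientUniformisedDatum} {h₃ : CMAbelianVarietyRealised} {hA : Arapura2012_Cor_15_4_6}
    {L : HodgeCM.CMField} {ι₁ : L →+* ℂ} {V : HodgeCM.HermSpace3 L ι₁} {h : exists_recordSystem}
    {Φ : Literature.AlgebraicGeometry.Motives.CMType L} {isotropicAt : ℕ → Prop}
    {C : Sec42Data (Model.honestP5IdOf h ⟨L.K⟩ ι₁ ⟨V.Hm, V.isHermitian, V.signature_ι₁, V.posDef_of_ne⟩ Φ) isotropicAt}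
    {T : C.HeckeTranslates} [Algebra L ℂ] (J : ComponentAlbaneseId hHD hI hU h₃ hA V h Φ C T)
    {C' : Sec42Data (Model.honestP5IdOf h ⟨L.K⟩ ι₁ ⟨V.Hm, V.isHermitian, V.signature_ι₁, V.posDef_of_ne⟩ Φ) isotropicAt}
    (e : C = C') : ComponentAlbaneseId hHD hI hU h₃ hA V h Φ C' (cast (congrArg (fun C₀ => Sec42Data.HeckeTranslates C₀) e) T) := by
  subst e; exact J

/-- **LAW (v′) read on a homomorphism**: if `(alb K h ≫ φ_ℂ)^* = 0` on `H¹` for every index `h`, then `φ = 0`.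
[cite: Liu2021, proof of Lemma 2.4 (1) (FJcycle.tex l. 1220–1228)] -/
theorem eq_zero_of_pull_alb_comp_eq_zero {hHD : exists_isReal_hodgeModel} {hI : hodgePQ_independent_of_hodgeModel}
    {hU : BallQuotientUniformisedDatum} {h₃ : CMAbelianVarietyRealised} {hA : Arapura2012_Cor_15_4_6}
    {L : HodgeCM.CMField} {ι₁ : L →+* ℂ} {V : HodgeCM.HermSpace3 L ι₁} {h : exists_recordSystem}
    {Φ : Literature.AlgebraicGeometry.Motives.CMType L} {isotropicAt : ℕ → Prop}
    {C : Sec42Data (Model.honestP5IdOf h ⟨L.K⟩ ι₁ ⟨V.Hm, V.isHermitian, V.signature_ι₁, V.posDef_of_ne⟩ Φ) isotropicAt}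
    {T : C.HeckeTranslates} [Algebra L ℂ] 
    (J : ComponentAlbaneseId hHD hI hU h₃ hA V h Φ C T) (K : C5.SmallLevel C.S.K₀) {B : AbelianVariety L} (φ : C.A K ⟶ B)
    (hφ : ∀ g : ↥V.adelicFin, BettiUniverse.pull (J.alb K g ≫ (AbelianVariety.Hom.baseChange ℂ φ).hom.hom.hom) 1 = 0) :
    φ = 0 := by
  by_contra hne
  obtain ⟨g, hg⟩ := J.alb_detect K φ hne
  exact hg (hφ g)

end ComponentAlbaneseId

end Summit.HodgeConjecture.CorCM.D2Bridge.Iota1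

end
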